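import Literature.AlgebraicGeometry.Modules.SerreTwistLaurent
import Literature.AlgebraicGeometry.Modules.SerreTwistModCharts
import Literature.AlgebraicGeometry.Morphisms.CechModule
import HarnessLib

/-!
# The evaluation `Θ` of the algebraic Čech pieces `(P^J_{X_s})_n` on the twists `G(n)` of a module

Let `ι : Z ⟶ 𝐏ʳ_A`, `G` an `𝒪_Z`-module and `g : J → Γ(Z, G(m₀))` finitely many global sections of the
twist `G(m₀)` (`Modules/SerreTwistMod`). For the free graded module `F = ⊕_{j ∈ J} P(-m₀)` over
`P = A[x₀, …, x_r]` (`Literature/Algebra/Homology/LaurentCech`: the shift `cdeg J m₀ ≡ m₀`, the localized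
degree-`n` pieces `locDeg (cdeg J m₀) ⊤ s n ⊆ L^J`) this file constructs the `A`-linear evaluation maps

  `SerreTwist.Theta ι G m₀ g s n : (F_{X_s})_n →ₗ[A] Γ(Z_s, G(n))`,  `v ↦ (Σ_j (v_j / x_i^{n - m₀}) · (g_j)_i)_i`

(`thetaComp`, a twist family of degree `n` by the twisted cocycle identity `SerreTwist.twFun_cocycle`),
i.e. the sheaf-theoretic meaning of "`Σ_j v_j g_j ∈ Γ(Z_s, G(n))` for `v_j ∈ (P_{X_s})_{n - m₀}`"
(Hartshorne II Prop. 5.15 / III Thm. 5.2: the graded module `Γ_*(G)` receives `⊕ P(-m₀)`), together with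

* `Theta_res` — compatibility with the restrictions `Z_{s'} ⊆ Z_s` (`s ⊆ s'`), i.e. with the inclusions
  `(F_{X_s})_n ⊆ (F_{X_{s'}})_n`;
* `comp_Theta_smul` — semilinearity: for `w ∈ Adm s c` (`Modules/SerreTwistLaurent`) and `v ∈ (F_{X_s})_n`,
  `Θ_{n'}(w v)_i = (w / x_i^c) · Θ_n(v)_i` (`n' = c + n`); in particular for `w = x_s^N` (a unit on
  `Z_s ∩ Z_i`, `Theta_xs_smul_eq_zero_iff`) and for homogeneous polynomials.

The graded kernel of `Θ`, its identification with the kernels of the localized maps and the surjectivity of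
`Θ` are in `Modules/SerreTwistThetaKer`. Everything is proved; no named facts.

References: Hartshorne II Prop. 5.15, III Thm. 5.2 (proof); EGA III 2.2. [Hartshorne1977]
-/

noncomputable section

universe u

open CategoryTheory AlgebraicGeometry TopologicalSpace Opposite
open Literature.Algebra.Homology Literature.Algebra.Homology.LaurentCech
open Literature.AlgebraicGeometry.Morphisms Literature.AlgebraicGeometry.Morphisms.ProjCech

attribute [local instance] MvPolynomial.gradedAlgebra
  Literature.AlgebraicGeometry.Motives.ProjBaseChange.algebraBase

namespace Literature.AlgebraicGeometry.Modules

namespace SerreTwist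

variable {A : Type u} [CommRing A] {r : ℕ} {Z : Scheme.{u}} (ι : Z ⟶ PP A r) (G : Z.Modules)
variable {J : Type} [Fintype J] (m₀ : ℕ) (g : J → Γ(twistMod ι G m₀, ⊤))

/-- The constant shift `j ↦ m₀`: the free graded module `⊕_{j ∈ J} P(-m₀)`. [folklore] -/
abbrev cdeg (J : Type) (m₀ : ℕ) : J → ℤ := fun _ => (m₀ : ℤ)

variable (A) in
/-- The localized degree-`n` piece `(F_{X_s})_n` of the free graded module `F = ⊕_j P(-m₀)`. [folklore] -/
abbrev Floc (J : Type) (m₀ : ℕ) (s : Finset (Fin (r + 1))) (n : ℕ) : Submodule A (J → L A r) :=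
  locDeg (cdeg J m₀) (⊤ : Submodule (P A r) (J → P A r)) s (n : ℤ)

/-! ## The components of `Θ(v)` and the twist relation -/

omit [Fintype J] in
/-- The generator section `(g_j)_i` restricted to `Z_s ∩ Z_i`. [folklore] -/
def gAt (s : Finset (Fin (r + 1))) (i : Fin (r + 1)) (j : J) : Γ(G, Zop ι s ⊓ Zop ι {i}) :=
  G.presheaf.map (homOfLE (inf_le_inf_right (Zop ι {i}) (le_top : Zop ι s ≤ ⊤))).op (comp ι G (g j) i)

omit [Fintype J] in
/-- Restricting `gAt` into a smaller open. [folklore] -/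
theorem map_gAt (s : Finset (Fin (r + 1))) (i : Fin (r + 1)) (j : J) {V : Z.Opens} (h : V ≤ Zop ι s ⊓ Zop ι {i}) :
    G.presheaf.map (homOfLE h).op (gAt ι G m₀ g s i j) =
      G.presheaf.map (homOfLE (le_inf le_top (h.trans inf_le_right) : V ≤ ⊤ ⊓ Zop ι {i})).op (comp ι G (g j) i) := by
  rw [gAt, moduleMap_map_apply]

/-- **The `i`-th component of `Θ(v)`**: `Σ_j (v_j / x_i^{n - m₀}) · (g_j)_i ∈ Γ(G, Z_s ∩ Z_i)`. [folklore] -/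
def thetaComp (s : Finset (Fin (r + 1))) (n : ℕ) (v : J → L A r) (hv : v ∈ Floc A J m₀ s n) (i : Fin (r + 1)) :
    Γ(G, Zop ι s ⊓ Zop ι {i}) :=
  ∑ j, twFun ι s i ((n : ℤ) - m₀) (v j) (mem_Adm_of_mem_locDeg (cdeg J m₀) hv j) • gAt ι G m₀ g s i j

/-- **`Θ(v)` is a twist family of degree `n`** (twisted cocycle identity and the degree-`m₀` relation of the
`g_j`). [folklore] -/
theorem isTwistFamily_thetaComp (s : Finset (Fin (r + 1))) (n : ℕ) (v : J → L A r) (hv : v ∈ Floc A J m₀ s n) :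
    IsTwistFamily ι G n (Zop ι s) (thetaComp ι G m₀ g s n v hv) := by
  intro i i' V hV hi hi'
  rw [thetaComp, thetaComp, map_sum, map_sum, Finset.smul_sum]
  refine Finset.sum_congr rfl fun j _ => ?_
  have hVi : V ≤ Zop ι s ⊓ Zop ι {i} := le_inf hV hi
  have hVi' : V ≤ Zop ι s ⊓ Zop ι {i'} := le_inf hV hi'
  have hg := isTwistFamily_comp ι G (g j) i i' (V := V) le_top hi hi'
  rw [Scheme.Modules.map_smul, Scheme.Modules.map_smul, map_gAt, map_gAt,
    moduleMap_congr G _ (le_inf le_top hi) (comp ι G (g j) i), hg, smul_smul, smul_smul]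
  congr 1
  have key := twFun_cocycle ι s i i' (a := m₀) (b := n) (c := (n : ℤ) - m₀) (by omega) (v j)
    (mem_Adm_of_mem_locDeg (cdeg J m₀) hv j) hVi hVi'
  rw [map_congr (hVi.trans inf_le_right) hi] at key
  exact key

/-- `Θ(v) ∈ Γ(Z_s, G(n))` as a section of the twist. [folklore] -/
def thetaFam (s : Finset (Fin (r + 1))) (n : ℕ) (v : J → L A r) (hv : v ∈ Floc A J m₀ s n) :
    Γ(twistMod ι G n, Zop ι s) :=
  mkFamily ι G (thetaComp ι G m₀ g s n v hv) (isTwistFamily_thetaComp ι G m₀ g s n v hv)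

/-- Components of `thetaFam`. [folklore] -/
@[simp]
theorem comp_thetaFam (s : Finset (Fin (r + 1))) (n : ℕ) (v : J → L A r) (hv : v ∈ Floc A J m₀ s n) (i : Fin (r + 1)) :
    comp ι G (thetaFam ι G m₀ g s n v hv) i =
      ∑ j, twFun ι s i ((n : ℤ) - m₀) (v j) (mem_Adm_of_mem_locDeg (cdeg J m₀) hv j) • gAt ι G m₀ g s i j := rfl

/-- `thetaFam` only depends on the vector (proof irrelevance / congruence). [folklore] -/
theorem thetaFam_congr (s : Finset (Fin (r + 1))) (n : ℕ) {v w : J → L A r} (h : v = w) (hv : v ∈ Floc A J m₀ s n)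
    (hw : w ∈ Floc A J m₀ s n) : thetaFam ι G m₀ g s n v hv = thetaFam ι G m₀ g s n w hw := by
  subst h; rfl

/-- `thetaFam` is additive. [folklore] -/
theorem thetaFam_add (s : Finset (Fin (r + 1))) (n : ℕ) (v w : J → L A r) (hv : v ∈ Floc A J m₀ s n)
    (hw : w ∈ Floc A J m₀ s n) :
    thetaFam ι G m₀ g s n (v + w) (add_mem hv hw) = thetaFam ι G m₀ g s n v hv + thetaFam ι G m₀ g s n w hw := by
  refine twistMod_ext ι G fun i => ?_
  rw [comp_add, comp_thetaFam, comp_thetaFam, comp_thetaFam, ← Finset.sum_add_distrib]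
  refine Finset.sum_congr rfl fun j _ => ?_
  rw [← add_smul]
  congr 1
  exact twFun_add ι s i _ (v j) (w j) (mem_Adm_of_mem_locDeg (cdeg J m₀) hv j) (mem_Adm_of_mem_locDeg (cdeg J m₀) hw j)

/-- `thetaFam` is `A`-linear: `Θ(a v) = a · Θ(v)` with `a` acting through `A → Γ(Z, 𝒪_Z)`. [folklore] -/
theorem thetaFam_smul (s : Finset (Fin (r + 1))) (n : ℕ) (a : A) (v : J → L A r) (hv : v ∈ Floc A J m₀ s n) :
    thetaFam ι G m₀ g s n (a • v) (Submodule.smul_mem _ a hv) =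
      Z.presheaf.map (homOfLE (le_top : Zop ι s ≤ ⊤)).op (algebraMapΓ (strZ ι) a) • thetaFam ι G m₀ g s n v hv := by
  refine twistMod_ext ι G fun i => ?_
  rw [comp_smul, comp_thetaFam, comp_thetaFam, Finset.smul_sum, IsTwistSection.map_map_apply]
  refine Finset.sum_congr rfl fun j _ => ?_
  rw [smul_smul]
  congr 1
  exact twFun_smul ι s i _ a (v j) (mem_Adm_of_mem_locDeg (cdeg J m₀) hv j)

/-! ## The linear map `Θ` -/

/-- **`Θ_{s,n} : (F_{X_s})_n →ₗ[A] Γ(Z_s, G(n))`, `v ↦ (Σ_j (v_j/x_i^{n-m₀}) (g_j)_i)_i`.** [folklore] -/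
def Theta (s : Finset (Fin (r + 1))) (n : ℕ) : Floc A J m₀ s n →ₗ[A] MSections (strZ ι) (twistMod ι G n) (Zop ι s) where
  toFun v := thetaFam ι G m₀ g s n v.1 v.2
  map_add' v w := thetaFam_add ι G m₀ g s n v.1 w.1 v.2 w.2
  map_smul' a v := thetaFam_smul ι G m₀ g s n a v.1 v.2

/-- `Theta` unfolded. [folklore] -/
theorem Theta_apply (s : Finset (Fin (r + 1))) (n : ℕ) (v : Floc A J m₀ s n) :
    Theta ι G m₀ g s n v = thetaFam ι G m₀ g s n v.1 v.2 := rfl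

/-- `Theta` on an explicit vector. [folklore] -/
theorem Theta_mk (s : Finset (Fin (r + 1))) (n : ℕ) (v : J → L A r) (hv : v ∈ Floc A J m₀ s n) :
    Theta ι G m₀ g s n ⟨v, hv⟩ = thetaFam ι G m₀ g s n v hv := rfl

/-- Components of `Θ(v)`. [folklore] -/
theorem comp_Theta (s : Finset (Fin (r + 1))) (n : ℕ) (v : Floc A J m₀ s n) (i : Fin (r + 1)) :
    comp ι G (Theta ι G m₀ g s n v) i =
      ∑ j, twFun ι s i ((n : ℤ) - m₀) (v.1 j) (mem_Adm_of_mem_locDeg (cdeg J m₀) v.2 j) • gAt ι G m₀ g s i j := rfl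

/-! ## Compatibility with restriction -/

/-- **`Θ` commutes with restriction**: for `s ⊆ s'` and `v ∈ (F_{X_s})_n ⊆ (F_{X_{s'}})_n`,
`Θ_{s',n}(v) = Θ_{s,n}(v)|_{Z_{s'}}`. [folklore] -/
theorem Theta_res {s s' : Finset (Fin (r + 1))} (hss' : s ⊆ s') (n : ℕ) (v : J → L A r) (hv : v ∈ Floc A J m₀ s n) :
    Theta ι G m₀ g s' n ⟨v, locDeg_mono (cdeg J m₀) ⊤ (n : ℤ) hss' hv⟩ =
      MSections.res (strZ ι) (twistMod ι G n) (Zop_mono ι hss') (Theta ι G m₀ g s n ⟨v, hv⟩) := by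
  refine twistMod_ext ι G fun i => ?_
  rw [comp_Theta, MSections.res_apply, comp_map, comp_Theta, map_sum]
  refine Finset.sum_congr rfl fun j _ => ?_
  rw [Scheme.Modules.map_smul, gAt, gAt, moduleMap_map_apply]
  congr 1
  have h := twFun_res ι hss' i ((n : ℤ) - m₀) (v j) (mem_Adm_of_mem_locDeg (cdeg J m₀) hv j)
  exact h

/-! ## Semilinearity over Laurent multipliers -/

omit [Fintype J] in
/-- Multiplying a vector of `(F_{X_s})_n` by `w ∈ Adm s c` lands in `(F_{X_s})_{n'}`, `n' = c + n`. [folklore] -/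
theorem smul_mem_Floc {s : Finset (Fin (r + 1))} {c d : ℤ} {n' : ℕ} (hn' : (n' : ℤ) = c + d) {w : L A r}
    (hw : w ∈ Adm A r s c) {v : J → L A r} (hv : v ∈ locDeg (cdeg J m₀) (⊤ : Submodule (P A r) (J → P A r)) s d) :
    w • v ∈ Floc A J m₀ s n' := by
  obtain ⟨hwdeg, N, p, hp⟩ := hw
  obtain ⟨⟨N', k, -, hk⟩, hdeg⟩ := hv
  refine ⟨⟨N + N', p • k, Submodule.mem_top, ?_⟩, ?_⟩
  · rw [Nat.cast_add, xs_add, ιK_smul, ← hp, ← hk, smul_smul, smul_smul]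
    congr 1
    ring
  · have hdeg' := (mem_Kdeg (cdeg J m₀)).mp hdeg
    change w • v ∈ Kdeg A r (cdeg J m₀) (n' : ℤ)
    refine (mem_Kdeg (cdeg J m₀)).mpr fun j => ?_
    rw [Pi.smul_apply, smul_eq_mul, hn', show c + d - cdeg J m₀ j = c + (d - cdeg J m₀ j) by ring]
    exact mul_mem_Ldeg hwdeg (hdeg' j)

/-- A vector all of whose components lie in `Adm s (n - m₀)` lies in `(F_{X_s})_n` (`J` finite: clear the
denominators uniformly). [folklore] -/
theorem mem_Floc_of_forall_mem_Adm {s : Finset (Fin (r + 1))} {n : ℕ} {v : J → L A r}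
    (hv : ∀ j, v j ∈ Adm A r s ((n : ℤ) - m₀)) : v ∈ Floc A J m₀ s n := by
  classical
  choose N p hp using fun j => (hv j).2
  refine ⟨⟨Finset.univ.sup N, fun j => Xs A s ^ (Finset.univ.sup N - N j) * p j, Submodule.mem_top,
    funext fun j => ?_⟩, (mem_Kdeg (cdeg J m₀)).mpr fun j => (hv j).1⟩
  have hNj : N j ≤ Finset.univ.sup N := Finset.le_sup (f := N) (Finset.mem_univ j)
  rw [Pi.smul_apply, smul_eq_mul, ιK_apply, map_mul, toL_Xs_pow, ← hp j, ← mul_assoc, ← xs_add]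
  congr 2
  push_cast [Nat.cast_sub hNj]
  ring

/-- **Semilinearity of `Θ`**: `Θ_{n'}(w v)_i = (w/x_i^c) · Θ_n(v)_i` for `w ∈ Adm s c`, `n' = c + n`. [folklore] -/
theorem comp_Theta_smul {s : Finset (Fin (r + 1))} {c : ℤ} {n n' : ℕ} (hn' : (n' : ℤ) = c + n) {w : L A r}
    (hw : w ∈ Adm A r s c) (v : J → L A r) (hv : v ∈ Floc A J m₀ s n) (hwv : w • v ∈ Floc A J m₀ s n')
    (i : Fin (r + 1)) :
    comp ι G (Theta ι G m₀ g s n' ⟨w • v, hwv⟩) i = twFun ι s i c w hw • comp ι G (Theta ι G m₀ g s n ⟨v, hv⟩) i := by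
  rw [comp_Theta, comp_Theta, Finset.smul_sum]
  refine Finset.sum_congr rfl fun j _ => ?_
  rw [smul_smul]
  congr 1
  have hdeg : (n' : ℤ) - m₀ = c + ((n : ℤ) - m₀) := by rw [hn']; ring
  have h := twFun_mul ι s i c ((n : ℤ) - m₀) w (v j) hw (mem_Adm_of_mem_locDeg (cdeg J m₀) hv j)
  rw [← h]
  exact twFun_congr_deg ι s i hdeg _ _ _

/-- **Multiplication by `x_s^N`**: `Θ_{n + N #s}(x_s^N v)_i = (x_s^N / x_i^{N #s}) · Θ_n(v)_i`. [folklore] -/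
theorem comp_Theta_xs_smul {s : Finset (Fin (r + 1))} (N : ℕ) {n n' : ℕ} (hn' : n' = n + N * s.card)
    (v : J → L A r) (hv : v ∈ Floc A J m₀ s n) (hxv : xs A s N • v ∈ Floc A J m₀ s n') (i : Fin (r + 1)) :
    comp ι G (Theta ι G m₀ g s n' ⟨xs A s N • v, hxv⟩) i =
      twFun ι s i ((N : ℤ) * s.card) (xs A s N) (xs_mem_Adm s N) • comp ι G (Theta ι G m₀ g s n ⟨v, hv⟩) i :=
  comp_Theta_smul ι G m₀ g (by rw [hn']; push_cast; ring) (xs_mem_Adm s N) v hv hxv i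

omit [Fintype J] in
/-- `x_s^N v ∈ (F_{X_s})_{n + N #s}` for `v ∈ (F_{X_s})_n`. [folklore] -/
theorem xs_smul_mem_Floc {s : Finset (Fin (r + 1))} (N : ℕ) {n : ℕ} {v : J → L A r} (hv : v ∈ Floc A J m₀ s n) :
    xs A s N • v ∈ Floc A J m₀ s (n + N * s.card) :=
  smul_mem_Floc m₀ (by push_cast; ring) (xs_mem_Adm s N) hv

/-- **`Θ_n(v) = 0` iff `Θ_{n + N #s}(x_s^N v) = 0`** (`x_s^N / x_i^{N #s}` is a unit on `Z_s ∩ Z_i`). [folklore] -/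
theorem Theta_xs_smul_eq_zero_iff {s : Finset (Fin (r + 1))} (N : ℕ) {n n' : ℕ} (hn' : n' = n + N * s.card)
    (v : J → L A r) (hv : v ∈ Floc A J m₀ s n) (hxv : xs A s N • v ∈ Floc A J m₀ s n') :
    Theta ι G m₀ g s n' ⟨xs A s N • v, hxv⟩ = 0 ↔ Theta ι G m₀ g s n ⟨v, hv⟩ = 0 := by
  constructor
  · intro h
    refine twistMod_ext ι G fun i => ?_
    have hi : comp ι G (Theta ι G m₀ g s n' ⟨xs A s N • v, hxv⟩) i = 0 := by rw [h]; rfl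
    rw [comp_Theta_xs_smul ι G m₀ g N hn' v hv hxv i] at hi
    obtain ⟨b, hb⟩ := (isUnit_twFun_xs ι s i (N : ℤ)).exists_left_inv
    change comp ι G (Theta ι G m₀ g s n ⟨v, hv⟩) i = 0
    rw [← one_smul Γ(Z, Zop ι s ⊓ Zop ι {i}) (comp ι G (Theta ι G m₀ g s n ⟨v, hv⟩) i), ← hb, mul_smul,
      hi, smul_zero]
  · intro h
    refine twistMod_ext ι G fun i => ?_
    rw [comp_Theta_xs_smul ι G m₀ g N hn' v hv hxv i, h]
    exact smul_zero _

end SerreTwist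

end Literature.AlgebraicGeometry.Modules

end
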